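import Summits.Ventures.HodgeRepro2.T5SU11JacobiWeight
import Summits.Ventures.HodgeRepro2.T5SU11SphericalLogConvex

/-!
# The Jacobi transform is JOINTLY log-convex in `(k, λ)`

`T5SU11XiTransform` (Bohr–Mollerup on the closed form) showed `λ ↦ m̂_k(λ)` log-convex on the strip, and
`T5SU11JacobiWeight` (Hölder) showed `k ↦ m̂_k(λ)` log-convex on the ray. Both are restrictions of one
statement: on the open convex domain `D = {(k, λ) : k > 1, λ < k, k + λ > 2}` of the transform
(`convex_jacobiDomain`), **`(k, λ) ↦ log m̂_k(λ)` is convex** (`convexOn_log_jacobi_joint`).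
The integrand `m_k(g) φ_λ(g) = e^{−k s(g)} φ_λ(g)` is jointly log-convex pointwise — exactly in `k`
(`T5SU11JacobiWeight`) and by the log-convexity of the spherical function in `λ`
(`T5SU11SphericalLogConvex.sph_combination_le`) — and Hölder's inequality for a pair of non-negative
integrable functions, **`∫ f^a h^b ≤ (∫ f)^a (∫ h)^b`** for `a + b = 1` (`integral_rpow_mul_rpow_le`,
the inequality of `T5SU11JacobiWeight` in its general form), integrates the pointwise bound
(`jacobi_joint_mul_add_mul_le`: `m̂_{a k₁ + b k₂}(a λ₁ + b λ₂) ≤ m̂_{k₁}(λ₁)^a m̂_{k₂}(λ₂)^b`). The transform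
itself is then convex in each variable and jointly (`convexOn_jacobi_joint`, weighted AM–GM), hence —
`D` being open in `ℝ²` — **jointly continuous, indeed locally Lipschitz** (`continuousOn_jacobi_joint`,
`locallyLipschitzOn_jacobi_joint`, `continuousOn_log_jacobi_joint`; Mathlib's `ConvexOn.continuousOn`).
Nothing is claimed about (N).

Blind lane: Mathlib + the HodgeRepro2 prefix only; no sorry; axioms ⊆ {propext, Classical.choice,
Quot.sound}.
-/

namespace Summit.Ventures.HodgeRepro2.T5SU11JacobiJointLogConvex

open MeasureTheory MeasureTheory.Measure Metric Set Filter Topology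
open T5SU11Unimodular T5SU11Fibration T5SU11Cartan T5HaarCircle T5BergmanCoefficient
  T5SU11FibrationHaar T5SU11SphericalFunction T5SU11SphericalSymmetry T5SU11SphericalBounds
  T5SU11SphericalContinuous T5SU11SphericalLogConvex T5SU11JacobiIwasawa T5SU11JacobiTransform
  T5SU11KFiniteMajorantPow T5SU11JacobiWeight
open scoped Real ENNReal

/-! ### The domain -/

/-- **The open domain `D = {(k, λ) : k > 1, λ < k, k + λ > 2}` of the transform is convex.** -/
theorem convex_jacobiDomain :
    Convex ℝ {p : ℝ × ℝ | 1 < p.1 ∧ p.2 < p.1 ∧ 2 < p.1 + p.2} := by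
  rw [convex_iff_forall_pos]
  rintro ⟨k₁, l₁⟩ ⟨h1, h2, h3⟩ ⟨k₂, l₂⟩ ⟨h1', h2', h3'⟩ a b ha hb hab
  simp only [mem_setOf_eq, Prod.smul_mk, Prod.mk_add_mk, smul_eq_mul] at *
  refine ⟨?_, ?_, ?_⟩
  · nlinarith [mul_pos ha (sub_pos.mpr h1), mul_pos hb (sub_pos.mpr h1')]
  · nlinarith [mul_pos ha (sub_pos.mpr h2), mul_pos hb (sub_pos.mpr h2')]
  · nlinarith [mul_pos ha (sub_pos.mpr h3), mul_pos hb (sub_pos.mpr h3')]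

/-- The domain `D` is open. -/
theorem isOpen_jacobiDomain : IsOpen {p : ℝ × ℝ | 1 < p.1 ∧ p.2 < p.1 ∧ 2 < p.1 + p.2} := by
  have h1 : IsOpen {p : ℝ × ℝ | 1 < p.1} := isOpen_lt continuous_const continuous_fst
  have h2 : IsOpen {p : ℝ × ℝ | p.2 < p.1} := isOpen_lt continuous_snd continuous_fst
  have h3 : IsOpen {p : ℝ × ℝ | 2 < p.1 + p.2} :=
    isOpen_lt continuous_const (continuous_fst.add continuous_snd)
  have e : {p : ℝ × ℝ | 1 < p.1 ∧ p.2 < p.1 ∧ 2 < p.1 + p.2}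
      = {p : ℝ × ℝ | 1 < p.1} ∩ {p : ℝ × ℝ | p.2 < p.1} ∩ {p : ℝ × ℝ | 2 < p.1 + p.2} := by
    ext p
    simp only [mem_setOf_eq, mem_inter_iff, and_assoc]
  rw [e]
  exact (h1.inter h2).inter h3

section measure

variable [MeasurableSpace Circle] [BorelSpace Circle]

/-! ### The pointwise bound -/

/-- The integrand is jointly log-convex pointwise:
`m_{a k₁ + b k₂}(g) φ_{a λ₁ + b λ₂}(g) ≤ (m_{k₁}(g) φ_{λ₁}(g))^a (m_{k₂}(g) φ_{λ₂}(g))^b`. -/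
theorem orbit_rpow_mul_sph_combination_le {a b : ℝ} (ha : 0 < a) (hb : 0 < b) (hab : a + b = 1)
    (k₁ l₁ k₂ l₂ : ℝ) (g : SU11) :
    (1 - ‖orbit g‖ ^ 2) ^ ((a * k₁ + b * k₂) / 2) * sph (a * l₁ + b * l₂) g
      ≤ ((1 - ‖orbit g‖ ^ 2) ^ (k₁ / 2) * sph l₁ g) ^ a
        * ((1 - ‖orbit g‖ ^ 2) ^ (k₂ / 2) * sph l₂ g) ^ b := by
  have hx : 0 < 1 - ‖orbit g‖ ^ 2 := one_sub_norm_orbit_sq_pos g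
  have hs₁ : 0 < sph l₁ g := sph_pos l₁ g
  have hs₂ : 0 < sph l₂ g := sph_pos l₂ g
  have hm : (1 - ‖orbit g‖ ^ 2) ^ ((a * k₁ + b * k₂) / 2)
      = (1 - ‖orbit g‖ ^ 2) ^ (k₁ / 2 * a) * (1 - ‖orbit g‖ ^ 2) ^ (k₂ / 2 * b) := by
    rw [← Real.rpow_add hx]
    congr 1
    ring
  rw [Real.mul_rpow (Real.rpow_nonneg hx.le _) hs₁.le, Real.mul_rpow (Real.rpow_nonneg hx.le _) hs₂.le,
    ← Real.rpow_mul hx.le, ← Real.rpow_mul hx.le, hm, mul_mul_mul_comm]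
  exact mul_le_mul_of_nonneg_left (sph_combination_le ha hb hab l₁ l₂ g)
    (mul_nonneg (Real.rpow_nonneg hx.le _) (Real.rpow_nonneg hx.le _))


/-! ### Hölder for a pair of non-negative integrable functions -/

omit [BorelSpace Circle] in
/-- **Hölder**: for continuous non-negative integrable `f, h` on `G` and `a, b > 0`, `a + b = 1`,
`∫_G f^a h^b dν ≤ (∫_G f dν)^a (∫_G h dν)^b`. -/
theorem integral_rpow_mul_rpow_le {f h : SU11 → ℝ} (hf : Continuous f) (hh : Continuous h)
    (hf0 : ∀ g, 0 ≤ f g) (hh0 : ∀ g, 0 ≤ h g) (hfi : Integrable f (nu haarCircle))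
    (hhi : Integrable h (nu haarCircle)) {a b : ℝ} (ha : 0 < a) (hb : 0 < b) (hab : a + b = 1) :
    ∫ g, f g ^ a * h g ^ b ∂(nu haarCircle)
      ≤ (∫ g, f g ∂(nu haarCircle)) ^ a * (∫ g, h g ∂(nu haarCircle)) ^ b := by
  have e : Real.HolderConjugate (1 / a) (1 / b) := Real.holderConjugate_one_div ha hb hab
  have memLp : ∀ {c : ℝ} {u : SU11 → ℝ}, 0 < c → Continuous u → (∀ g, 0 ≤ u g) →
      Integrable u (nu haarCircle) → MemLp (fun g => u g ^ c) (ENNReal.ofReal (1 / c)) (nu haarCircle) := by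
    intro c u hc hu hu0 hui
    have A : ENNReal.ofReal (1 / c) ≠ 0 := by
      rwa [Ne, ENNReal.ofReal_eq_zero, not_le, one_div_pos]
    have B : ENNReal.ofReal (1 / c) ≠ ∞ := ENNReal.ofReal_ne_top
    have hc' : Continuous fun g => u g ^ c := hu.rpow_const fun _ => Or.inr hc.le
    rw [← memLp_norm_rpow_iff hc'.aestronglyMeasurable A B,
      ENNReal.toReal_ofReal (one_div_nonneg.mpr hc.le), ENNReal.div_self A B,
      memLp_one_iff_integrable]
    refine hui.congr (Filter.Eventually.of_forall fun g => ?_)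
    show u g = ‖u g ^ c‖ ^ (1 / c)
    rw [Real.norm_of_nonneg (Real.rpow_nonneg (hu0 g) _), ← Real.rpow_mul (hu0 g),
      mul_one_div_cancel hc.ne', Real.rpow_one]
  have key := MeasureTheory.integral_mul_le_Lp_mul_Lq_of_nonneg e
    (Filter.Eventually.of_forall fun g => Real.rpow_nonneg (hf0 g) a)
    (Filter.Eventually.of_forall fun g => Real.rpow_nonneg (hh0 g) b)
    (memLp ha hf hf0 hfi) (memLp hb hh hh0 hhi)
  rw [one_div_one_div, one_div_one_div] at key
  have e1 : ∀ g, (f g ^ a) ^ (1 / a) = f g := fun g => by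
    rw [← Real.rpow_mul (hf0 g), mul_one_div_cancel ha.ne', Real.rpow_one]
  have e2 : ∀ g, (h g ^ b) ^ (1 / b) = h g := fun g => by
    rw [← Real.rpow_mul (hh0 g), mul_one_div_cancel hb.ne', Real.rpow_one]
  simp_rw [e1, e2] at key
  exact key

omit [BorelSpace Circle] in
/-- `f^a h^b ≤ a f + b h` (weighted AM–GM), so `f^a h^b` is integrable. -/
theorem integrable_rpow_mul_rpow {f h : SU11 → ℝ} (hf : Continuous f) (hh : Continuous h)
    (hf0 : ∀ g, 0 ≤ f g) (hh0 : ∀ g, 0 ≤ h g) (hfi : Integrable f (nu haarCircle))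
    (hhi : Integrable h (nu haarCircle)) {a b : ℝ} (ha : 0 < a) (hb : 0 < b) (hab : a + b = 1) :
    Integrable (fun g => f g ^ a * h g ^ b) (nu haarCircle) := by
  refine Integrable.mono' ((hfi.const_mul a).add (hhi.const_mul b))
    ((hf.rpow_const fun _ => Or.inr ha.le).mul (hh.rpow_const fun _ => Or.inr hb.le)).aestronglyMeasurable
    (Filter.Eventually.of_forall fun g => ?_)
  rw [Real.norm_of_nonneg (mul_nonneg (Real.rpow_nonneg (hf0 g) _) (Real.rpow_nonneg (hh0 g) _))]
  exact Real.geom_mean_le_arith_mean2_weighted ha.le hb.le (hf0 g) (hh0 g) hab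

/-! ### Joint log-convexity -/

/-- **The multiplicative form**: for `(k₁, λ₁), (k₂, λ₂) ∈ D` and `a, b > 0`, `a + b = 1`,
`m̂_{a k₁ + b k₂}(a λ₁ + b λ₂) ≤ m̂_{k₁}(λ₁)^a · m̂_{k₂}(λ₂)^b`. -/
theorem jacobi_joint_mul_add_mul_le {k₁ l₁ k₂ l₂ a b : ℝ} (hk₁ : 1 < k₁) (h11 : l₁ < k₁)
    (h12 : 2 < k₁ + l₁) (hk₂ : 1 < k₂) (h21 : l₂ < k₂) (h22 : 2 < k₂ + l₂) (ha : 0 < a) (hb : 0 < b)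
    (hab : a + b = 1) :
    ∫ g, (1 - ‖orbit g‖ ^ 2) ^ ((a * k₁ + b * k₂) / 2) * sph (a * l₁ + b * l₂) g ∂(nu haarCircle)
      ≤ (∫ g, (1 - ‖orbit g‖ ^ 2) ^ (k₁ / 2) * sph l₁ g ∂(nu haarCircle)) ^ a
        * (∫ g, (1 - ‖orbit g‖ ^ 2) ^ (k₂ / 2) * sph l₂ g ∂(nu haarCircle)) ^ b := by
  have hc₁ : Continuous fun g : SU11 => (1 - ‖orbit g‖ ^ 2) ^ (k₁ / 2) * sph l₁ g :=
    (continuous_orbit_rpow k₁).mul (continuous_sph l₁)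
  have hc₂ : Continuous fun g : SU11 => (1 - ‖orbit g‖ ^ 2) ^ (k₂ / 2) * sph l₂ g :=
    (continuous_orbit_rpow k₂).mul (continuous_sph l₂)
  have h0₁ : ∀ g, 0 ≤ (1 - ‖orbit g‖ ^ 2) ^ (k₁ / 2) * sph l₁ g := fun g =>
    mul_nonneg (orbit_rpow_nonneg k₁ g) (sph_pos l₁ g).le
  have h0₂ : ∀ g, 0 ≤ (1 - ‖orbit g‖ ^ 2) ^ (k₂ / 2) * sph l₂ g := fun g =>
    mul_nonneg (orbit_rpow_nonneg k₂ g) (sph_pos l₂ g).le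
  have hi₁ := integrable_orbit_rpow_mul_sph hk₁ h11 h12
  have hi₂ := integrable_orbit_rpow_mul_sph hk₂ h21 h22
  have hmid := integrable_rpow_mul_rpow hc₁ hc₂ h0₁ h0₂ hi₁ hi₂ ha hb hab
  have hk : 1 < a * k₁ + b * k₂ := by nlinarith [mul_pos ha (sub_pos.mpr hk₁), mul_pos hb (sub_pos.mpr hk₂)]
  have h1 : a * l₁ + b * l₂ < a * k₁ + b * k₂ := by
    nlinarith [mul_pos ha (sub_pos.mpr h11), mul_pos hb (sub_pos.mpr h21)]
  have h2 : 2 < a * k₁ + b * k₂ + (a * l₁ + b * l₂) := by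
    nlinarith [mul_pos ha (sub_pos.mpr h12), mul_pos hb (sub_pos.mpr h22)]
  calc ∫ g, (1 - ‖orbit g‖ ^ 2) ^ ((a * k₁ + b * k₂) / 2) * sph (a * l₁ + b * l₂) g ∂(nu haarCircle)
      ≤ ∫ g, ((1 - ‖orbit g‖ ^ 2) ^ (k₁ / 2) * sph l₁ g) ^ a
          * ((1 - ‖orbit g‖ ^ 2) ^ (k₂ / 2) * sph l₂ g) ^ b ∂(nu haarCircle) :=
        integral_mono (integrable_orbit_rpow_mul_sph hk h1 h2) hmid fun g =>
          orbit_rpow_mul_sph_combination_le ha hb hab k₁ l₁ k₂ l₂ g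
    _ ≤ _ := integral_rpow_mul_rpow_le hc₁ hc₂ h0₁ h0₂ hi₁ hi₂ ha hb hab

/-- **THE JACOBI TRANSFORM IS JOINTLY LOG-CONVEX** on `D`. -/
theorem convexOn_log_jacobi_joint :
    ConvexOn ℝ {p : ℝ × ℝ | 1 < p.1 ∧ p.2 < p.1 ∧ 2 < p.1 + p.2}
      (fun p : ℝ × ℝ => Real.log (∫ g, (1 - ‖orbit g‖ ^ 2) ^ (p.1 / 2) * sph p.2 g ∂(nu haarCircle))) := by
  refine convexOn_iff_forall_pos.mpr ⟨convex_jacobiDomain, ?_⟩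
  rintro ⟨k₁, l₁⟩ ⟨h1, h2, h3⟩ ⟨k₂, l₂⟩ ⟨h1', h2', h3'⟩ a b ha hb hab
  simp only [Prod.smul_mk, Prod.mk_add_mk, smul_eq_mul] at *
  have hx := jacobi_pos h1 h2 h3
  have hy := jacobi_pos h1' h2' h3'
  have hk : 1 < a * k₁ + b * k₂ := by nlinarith [mul_pos ha (sub_pos.mpr h1), mul_pos hb (sub_pos.mpr h1')]
  have hl : a * l₁ + b * l₂ < a * k₁ + b * k₂ := by
    nlinarith [mul_pos ha (sub_pos.mpr h2), mul_pos hb (sub_pos.mpr h2')]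
  have hkl : 2 < a * k₁ + b * k₂ + (a * l₁ + b * l₂) := by
    nlinarith [mul_pos ha (sub_pos.mpr h3), mul_pos hb (sub_pos.mpr h3')]
  have hz := jacobi_pos hk hl hkl
  rw [← Real.log_rpow hx, ← Real.log_rpow hy,
    ← Real.log_mul (Real.rpow_pos_of_pos hx a).ne' (Real.rpow_pos_of_pos hy b).ne']
  exact Real.log_le_log hz (jacobi_joint_mul_add_mul_le h1 h2 h3 h1' h2' h3' ha hb hab)

/-- **The transform itself is jointly convex** on `D` (log-convex ⇒ convex, weighted AM–GM). -/
theorem convexOn_jacobi_joint :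
    ConvexOn ℝ {p : ℝ × ℝ | 1 < p.1 ∧ p.2 < p.1 ∧ 2 < p.1 + p.2}
      (fun p : ℝ × ℝ => ∫ g, (1 - ‖orbit g‖ ^ 2) ^ (p.1 / 2) * sph p.2 g ∂(nu haarCircle)) := by
  refine convexOn_iff_forall_pos.mpr ⟨convex_jacobiDomain, ?_⟩
  rintro ⟨k₁, l₁⟩ ⟨h1, h2, h3⟩ ⟨k₂, l₂⟩ ⟨h1', h2', h3'⟩ a b ha hb hab
  simp only [Prod.smul_mk, Prod.mk_add_mk, smul_eq_mul] at *
  have hx := jacobi_pos h1 h2 h3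
  have hy := jacobi_pos h1' h2' h3'
  calc ∫ g, (1 - ‖orbit g‖ ^ 2) ^ ((a * k₁ + b * k₂) / 2) * sph (a * l₁ + b * l₂) g ∂(nu haarCircle)
      ≤ (∫ g, (1 - ‖orbit g‖ ^ 2) ^ (k₁ / 2) * sph l₁ g ∂(nu haarCircle)) ^ a
        * (∫ g, (1 - ‖orbit g‖ ^ 2) ^ (k₂ / 2) * sph l₂ g ∂(nu haarCircle)) ^ b :=
        jacobi_joint_mul_add_mul_le h1 h2 h3 h1' h2' h3' ha hb hab
    _ ≤ _ := Real.geom_mean_le_arith_mean2_weighted ha.le hb.le hx.le hy.le hab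

/-- **Joint continuity**: `(k, λ) ↦ m̂_k(λ)` is continuous on `D` (a convex function on an open subset of
`ℝ²` is continuous, Mathlib's `ConvexOn.continuousOn`). -/
theorem continuousOn_jacobi_joint :
    ContinuousOn
      (fun p : ℝ × ℝ => ∫ g, (1 - ‖orbit g‖ ^ 2) ^ (p.1 / 2) * sph p.2 g ∂(nu haarCircle))
      {p : ℝ × ℝ | 1 < p.1 ∧ p.2 < p.1 ∧ 2 < p.1 + p.2} :=
  convexOn_jacobi_joint.continuousOn isOpen_jacobiDomain

/-- **Joint local Lipschitz continuity** on `D` (`ConvexOn.locallyLipschitzOn`). -/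
theorem locallyLipschitzOn_jacobi_joint :
    LocallyLipschitzOn {p : ℝ × ℝ | 1 < p.1 ∧ p.2 < p.1 ∧ 2 < p.1 + p.2}
      (fun p : ℝ × ℝ => ∫ g, (1 - ‖orbit g‖ ^ 2) ^ (p.1 / 2) * sph p.2 g ∂(nu haarCircle)) :=
  convexOn_jacobi_joint.locallyLipschitzOn isOpen_jacobiDomain

/-- Joint continuity of the logarithm of the transform on `D`. -/
theorem continuousOn_log_jacobi_joint :
    ContinuousOn
      (fun p : ℝ × ℝ => Real.log (∫ g, (1 - ‖orbit g‖ ^ 2) ^ (p.1 / 2) * sph p.2 g ∂(nu haarCircle)))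
      {p : ℝ × ℝ | 1 < p.1 ∧ p.2 < p.1 ∧ 2 < p.1 + p.2} :=
  convexOn_log_jacobi_joint.continuousOn isOpen_jacobiDomain

/-- Convexity in `λ` alone, on the strip (the restriction of the joint statement). -/
theorem convexOn_jacobi {k : ℝ} (hk : 1 < k) :
    ConvexOn ℝ (Ioo (2 - k) k)
      (fun lam => ∫ g, (1 - ‖orbit g‖ ^ 2) ^ (k / 2) * sph lam g ∂(nu haarCircle)) := by
  refine convexOn_iff_forall_pos.mpr ⟨convex_Ioo _ _, fun x hx y hy a b ha hb hab => ?_⟩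
  simp only [smul_eq_mul]
  have hx' := jacobi_pos hk hx.2 (by linarith [hx.1])
  have hy' := jacobi_pos hk hy.2 (by linarith [hy.1])
  have h := jacobi_joint_mul_add_mul_le hk hx.2 (by linarith [hx.1]) hk hy.2 (by linarith [hy.1]) ha hb hab
  rw [show a * k + b * k = k by rw [← add_mul, hab, one_mul]] at h
  exact h.trans (Real.geom_mean_le_arith_mean2_weighted ha.le hb.le hx'.le hy'.le hab)

/-- Convexity in `k` alone, on the ray (the restriction of the joint statement). -/
theorem convexOn_jacobi_weight (lam : ℝ) :
    ConvexOn ℝ (Ioi (max 1 (max lam (2 - lam))))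
      (fun k => ∫ g, (1 - ‖orbit g‖ ^ 2) ^ (k / 2) * sph lam g ∂(nu haarCircle)) := by
  refine convexOn_iff_forall_pos.mpr ⟨convex_Ioi _, fun x hx y hy a b ha hb hab => ?_⟩
  rw [mem_Ioi, max_lt_iff, max_lt_iff] at hx hy
  simp only [smul_eq_mul]
  have hx' := jacobi_pos hx.1 hx.2.1 (by linarith [hx.2.2])
  have hy' := jacobi_pos hy.1 hy.2.1 (by linarith [hy.2.2])
  have h := jacobi_joint_mul_add_mul_le hx.1 hx.2.1 (by linarith [hx.2.2]) hy.1 hy.2.1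
    (by linarith [hy.2.2]) ha hb hab
  rw [show a * lam + b * lam = lam by rw [← add_mul, hab, one_mul]] at h
  exact h.trans (Real.geom_mean_le_arith_mean2_weighted ha.le hb.le hx'.le hy'.le hab)

end measure

end Summit.Ventures.HodgeRepro2.T5SU11JacobiJointLogConvex
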